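import Summits.AtomisticToContinuum.BoseEinsteinCondensation.Theses.BECInfraredBound
import Summits.AtomisticToContinuum.BoseEinsteinCondensation.Theorems.BECCutLineWeakDisorderGroundStateRigidityEssBounded
import Literature.MathematicalPhysics.QuantumManyBody.BoseGasCatStates

/-!
# Birth skeleton — crux `BecFreeGas` (stmt-AtomisticToContinuum-8912)
# route `BECInfraredBound` (rank 9, the free-gas branch of `closes`), file `Cruxes/BecFreeGas/Lines/birth.lean`

The crux (by name, `Summit.AtomisticToContinuum.BoseEinsteinCondensation.Theses.BECInfraredBound.BecFreeGas`):
for every repulsive finite-range `v` that is a.e. zero on `(0, ∞)`: `∃ ρ₀ > 0 ∀ ρ ∈ (0, ρ₀) ∃ c > 0 ∀ᶠ N ∃ δ > 0`,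
EVERY Dirichlet `δ`-near-minimiser `Ψ` of the `N`-body energy in the box of side `L = (N/ρ)^{1/3}` has
occupation of the flat mode `φ₀ = L^{-3/2} 1_{Λ_L}` at least `cN` (X_B1 at `v`).

## The line (typed): interaction invisible → free Dirichlet gas → ONE-BODY gap in the sine mode → flat mode

* GLUE, proved here from the tree (`GroundStateRigidity.energy_congr_offNull`, the collision planes and the
  positive radii where `v ≠ 0` form a null set of radii): `energy v Ψ = energy 0 Ψ` for every trial state, hence
  `E₀(v) = E₀(0)` — the crux is the free Dirichlet gas at EVERY density (`ρ₀ := 1` is arbitrary).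
* `stub_freeEnergyUpper` (M, provable now): the SHARP variational upper bound `E₀^D(0, N, L) ≤ 3π²N/L²`
  (`C¹` product states approximating `∏ᵢ χ_L(xᵢ)`, `χ_L(x) = ∏ₖ (2/L)^{1/2} sin(πxₖ/L)`, in `H¹`; the tree has
  only the crude bump bound `groundStateEnergy_zero_le`).  Sharpness at leading order is load-bearing: the gap
  argument below tolerates an energy excess `o(N/L²)` only.
* `stub_freeGapSineMode` (M–L, the hardest; provable): the ONE-BODY sharp Dirichlet Poincaré inequality WITH GAP on
  the cube, `∫|∇f|² ≥ (6π²/L²)‖f‖² − (3π²/L²)|⟨χ_L, f⟩|²` for `C¹` `f` vanishing off `Λ_L` (second Dirichlet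
  eigenvalue `6π²/L²`), lifted to `N` bosons by Bose symmetry `T = N∫|∇₀Ψ|²` and slicing exactly as the tree's
  `BoseGasFreeDirichletBEC.key_inequality`: `6π²N/L² ≤ T(Ψ) + (3π²/L²)·n_χ(Ψ)`.
* `stub_sineToFlatMode` (M, provable now): ONE-BODY MODE TRANSFER `χ_L ↦ φ₀`: universal `c₀, ε₀ > 0` with
  `n_χ(Ψ) ≥ (1 − ε₀)N ⇒ n_{φ₀}(Ψ) ≥ c₀N` (Minkowski in `L²(dY)` on the slices `x ↦ Ψ(x, Y)`, Cauchy–Schwarz on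
  `(1 − |χ⟩⟨χ|)φ₀`, and the explicit overlap `|⟨φ₀, χ_L⟩|² = (8/π²)³ ≈ 0.533`, scale-free; e.g. `ε₀ = 1/4`,
  `c₀ = 0.08`).

Composition `BecFreeGas_of` (sorry-free): at `v` a.e. zero, `ρ₀ := 1`, `c := c₀`; eventually `N ≥ 1`,
`δ := 3π²ε₀N/L²`; for a `δ`-near-minimiser, `energy 0 Ψ = energy v Ψ ≤ E₀(v) + δ = E₀(0) + δ ≤ 3π²N/L² + δ`
(glue + `stub_freeEnergyUpper`), so the gap inequality gives `n_χ ≥ (1 − ε₀)N` after cancelling `3π²/L²` in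
`ℝ≥0∞`, and the transfer stub gives `n_{φ₀} ≥ c₀N`.  `BecFreeGas_proof` concludes the crux BY NAME.

Disproof used: none relevant (no `Cruxes/BecFreeGas/Disproof.lean` at registration; the summit's negatives index
has no statement on the free gas / flat mode).  Consistent with the tree's negative lemma
`PeriodicToDirichlet.Negative.not_rewardedBoxBECAt_zero_flatCap` (flat-mode BEC of free near-minimisers fails for
a constant `flatCap < 1`): here `c₀ < (8/π²)³`.
-/

noncomputable section

namespace Summit.AtomisticToContinuum.BoseEinsteinCondensation.Cruxes.BecFreeGas.Birth

open Literature.MathematicalPhysics.QuantumManyBody.BoseGas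
open _root_.MeasureTheory _root_.Filter
open scoped ENNReal Topology
open Summit.AtomisticToContinuum.BoseEinsteinCondensation.Theses

/-! ### Stub statements — the PRECISE `Prop`s, in the sub-namespace `Stmt` under the stubs' own names
(`Stmt.stub_<name>` is the statement, `stub_<name>` below is the registered sorried theorem of exactly that type).
The one-particle Dirichlet ground mode of `Λ_L` is written out as the literal
`(box L).indicator fun x => ((∏ k : Fin 3, Real.sqrt (2 / L) * Real.sin (Real.pi * x k / L) : ℝ) : ℂ)`
(`χ_L`, normalised in `L²(Λ_L)`), the flat mode as the crux's literal `(box L).indicator fun _ => ((Real.sqrt (L ^ 3))⁻¹ : ℂ)`. -/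

namespace Stmt

/-- **Stub statement `stub_freeEnergyUpper`**: the sharp free Dirichlet upper bound `E₀^D(0, N, L) ≤ 3π²N/L²`
(`N ≥ 1`, `L > 0`). -/
def stub_freeEnergyUpper : Prop :=
  ∀ (N : ℕ) (L : ℝ), 0 < N → 0 < L →
    Literature.MathematicalPhysics.QuantumManyBody.BoseGas.groundStateEnergy 0 N L ≤
      ENNReal.ofReal (3 * Real.pi ^ 2 * N / L ^ 2)

/-- **Stub statement `stub_freeGapSineMode`**: the free Dirichlet gap inequality in the sine mode,
`6π²N/L² ≤ T(Ψ) + (3π²/L²) n_χ(Ψ)` for every Dirichlet trial state (`N ≥ 1`, `L > 0`). -/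
def stub_freeGapSineMode : Prop :=
  ∀ (N : ℕ) (L : ℝ), 0 < N → 0 < L →
    ∀ Ψ : Literature.MathematicalPhysics.QuantumManyBody.BoseGas.TrialState N L,
      ENNReal.ofReal (6 * Real.pi ^ 2 * N / L ^ 2) ≤
        Literature.MathematicalPhysics.QuantumManyBody.BoseGas.energy 0 Ψ +
          ENNReal.ofReal (3 * Real.pi ^ 2 / L ^ 2) *
            Literature.MathematicalPhysics.QuantumManyBody.BoseGas.occupation N
              ((Literature.MathematicalPhysics.QuantumManyBody.BoseGas.box L).indicator fun x =>
                ((∏ k : Fin 3, Real.sqrt (2 / L) * Real.sin (Real.pi * x k / L) : ℝ) : ℂ)) Ψ.ψ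

/-- **Stub statement `stub_sineToFlatMode`**: mode transfer `χ_L ↦ φ₀` with universal constants:
`n_χ(Ψ) ≥ (1 − ε₀)N ⇒ n_{φ₀}(Ψ) ≥ c₀N` for every Dirichlet trial state (`N ≥ 1`, `L > 0`). -/
def stub_sineToFlatMode : Prop :=
  ∃ c₀ : ℝ, 0 < c₀ ∧ ∃ ε₀ : ℝ, 0 < ε₀ ∧ ∀ (N : ℕ) (L : ℝ), 0 < N → 0 < L →
    ∀ Ψ : Literature.MathematicalPhysics.QuantumManyBody.BoseGas.TrialState N L,
      ENNReal.ofReal ((1 - ε₀) * N) ≤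
        Literature.MathematicalPhysics.QuantumManyBody.BoseGas.occupation N
          ((Literature.MathematicalPhysics.QuantumManyBody.BoseGas.box L).indicator fun x =>
            ((∏ k : Fin 3, Real.sqrt (2 / L) * Real.sin (Real.pi * x k / L) : ℝ) : ℂ)) Ψ.ψ →
      ENNReal.ofReal (c₀ * N) ≤
        Literature.MathematicalPhysics.QuantumManyBody.BoseGas.occupation N
          ((Literature.MathematicalPhysics.QuantumManyBody.BoseGas.box L).indicator fun _ =>
            ((Real.sqrt (L ^ 3))⁻¹ : ℂ)) Ψ.ψ

end Stmt

/-! ### Registered stubs (signatures fully qualified; the `example`s certify they are the named statements) -/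

/-- stub (M, provable now: `C¹` products approximating `∏ sin(πxᵢₖ/L)` in `H¹`; type = `Stmt.stub_freeEnergyUpper`). -/
theorem stub_freeEnergyUpper : ∀ (N : ℕ) (L : ℝ), 0 < N → 0 < L → Literature.MathematicalPhysics.QuantumManyBody.BoseGas.groundStateEnergy 0 N L ≤ ENNReal.ofReal (3 * Real.pi ^ 2 * N / L ^ 2) := by
  sorry

/-- stub (M–L, the hardest: one-body sharp Dirichlet Poincaré WITH GAP on the cube, lifted by Bose symmetry;
type = `Stmt.stub_freeGapSineMode`). -/
theorem stub_freeGapSineMode : ∀ (N : ℕ) (L : ℝ), 0 < N → 0 < L → ∀ Ψ : Literature.MathematicalPhysics.QuantumManyBody.BoseGas.TrialState N L, ENNReal.ofReal (6 * Real.pi ^ 2 * N / L ^ 2) ≤ Literature.MathematicalPhysics.QuantumManyBody.BoseGas.energy 0 Ψ + ENNReal.ofReal (3 * Real.pi ^ 2 / L ^ 2) * Literature.MathematicalPhysics.QuantumManyBody.BoseGas.occupation N ((Literature.MathematicalPhysics.QuantumManyBody.BoseGas.box L).indicator fun x => ((∏ k : Fin 3, Real.sqrt (2 / L) * Real.sin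 (Real.pi * x k / L) : ℝ) : ℂ)) Ψ.ψ := by
  sorry

/-- stub (M, provable now: Minkowski on slices + the overlap `(8/π²)³`; type = `Stmt.stub_sineToFlatMode`). -/
theorem stub_sineToFlatMode : ∃ c₀ : ℝ, 0 < c₀ ∧ ∃ ε₀ : ℝ, 0 < ε₀ ∧ ∀ (N : ℕ) (L : ℝ), 0 < N → 0 < L → ∀ Ψ : Literature.MathematicalPhysics.QuantumManyBody.BoseGas.TrialState N L, ENNReal.ofReal ((1 - ε₀) * N) ≤ Literature.MathematicalPhysics.QuantumManyBody.BoseGas.occupation N ((Literature.MathematicalPhysics.QuantumManyBody.BoseGas.box L).indicator fun x => ((∏ k : Fin 3, Real.sqrt (2 / L) * Real.sin (Real.pi * x k / L) : ℝ) : ℂ)) Ψ.ψ → ENNReal.ofReal (c₀ * N) ≤ Literature.MathematicalPhysics.QuantumManyBody.BoseGas.occupation N ((Literature.MathematicalPhysics.QuantumManyBody.BoseGas.box L).indicator fun _ => ((Real.sqrt (L ^ 3))⁻¹ : ℂ)) Ψ.ψ := by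
  sorry

example : Stmt.stub_freeEnergyUpper := stub_freeEnergyUpper
example : Stmt.stub_freeGapSineMode := stub_freeGapSineMode
example : Stmt.stub_sineToFlatMode := stub_sineToFlatMode

/-! ### Sorry-free glue -/

/-- `L = (N/ρ)^{1/3} > 0` for `ρ > 0`, `N ≥ 1`. [folklore] -/
theorem sideLength_pos' {ρ : ℝ} (hρ : 0 < ρ) {N : ℕ} (hN : 0 < N) : 0 < sideLength ρ N := by
  unfold sideLength
  exact Real.rpow_pos_of_pos (div_pos (Nat.cast_pos.2 hN) hρ) _

/-- **The interaction is invisible when `v` is a.e. zero on `(0, ∞)`**: the exceptional radii (`0` and the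
positive radii where `v ≠ 0`) form a Lebesgue-null set, off which `v` agrees with a potential vanishing on
`[0, ∞)`, whose interaction is identically zero; `energy_congr_offNull` (tree) does the measure theory.
[folklore] -/
theorem energy_eq_energy_zero {v : ℝ → ℝ≥0∞} (hv : IsRepulsiveFiniteRange v)
    (hae : ∀ᵐ r ∂(volume.restrict (Set.Ioi (0 : ℝ))), v r = 0) {N : ℕ} {L : ℝ}
    (Ψ : TrialState N L) : energy v Ψ = energy 0 Ψ := by
  -- the exceptional radii
  have hSm : MeasurableSet (({0} : Set ℝ) ∪ (Set.Ioi 0 ∩ v ⁻¹' {0}ᶜ)) :=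
    (measurableSet_singleton 0).union (measurableSet_Ioi.inter (hv.1 (measurableSet_singleton 0).compl))
  have hpos : volume (Set.Ioi (0 : ℝ) ∩ v ⁻¹' {0}ᶜ) = 0 := by
    have h1 : (volume.restrict (Set.Ioi (0 : ℝ))) {r | ¬ v r = 0} = 0 := ae_iff.1 hae
    rw [Measure.restrict_apply' measurableSet_Ioi] at h1
    refine measure_mono_null (fun r hr => ?_) h1
    exact ⟨hr.2, hr.1⟩
  have hS0 : volume (({0} : Set ℝ) ∪ (Set.Ioi 0 ∩ v ⁻¹' {0}ᶜ)) = 0 :=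
    measure_union_null Real.volume_singleton hpos
  -- the modified potential, vanishing on `[0, ∞)`
  have hvw : ∀ r, r ∉ (({0} : Set ℝ) ∪ (Set.Ioi 0 ∩ v ⁻¹' {0}ᶜ)) →
      v r = (fun s : ℝ => if 0 ≤ s then (0 : ℝ≥0∞) else v s) r := by
    intro r hr
    by_cases h0 : 0 ≤ r
    · have hv0 : v r = 0 := by
        by_contra hne
        rcases h0.eq_or_lt with h00 | h00
        · exact hr (Set.mem_union_left _ (Set.mem_singleton_iff.2 h00.symm))
        · exact hr (Set.mem_union_right _ (Set.mem_inter (Set.mem_Ioi.2 h00) (by simpa using hne)))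
      simp only [if_pos h0, hv0]
    · simp only [if_neg h0]
  have h1 : energy v Ψ = energy (fun s : ℝ => if 0 ≤ s then (0 : ℝ≥0∞) else v s) Ψ :=
    Summit.AtomisticToContinuum.BoseEinsteinCondensation.Theorems.GroundStateRigidity.energy_congr_offNull
      hSm hS0 hvw Ψ
  have hw0 : ∀ X : Config N, interaction (fun s : ℝ => if 0 ≤ s then (0 : ℝ≥0∞) else v s) X = 0 := by
    intro X
    unfold interaction
    exact Finset.sum_eq_zero fun i _ => Finset.sum_eq_zero fun j _ => by simp [dist_nonneg]
  have h2 : energy (fun s : ℝ => if 0 ≤ s then (0 : ℝ≥0∞) else v s) Ψ = energy 0 Ψ := by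
    simp only [energy, hw0, interaction_zeroPotential]
  rw [h1, h2]

/-- … hence the ground-state energies agree too. [folklore] -/
theorem groundStateEnergy_eq_zero {v : ℝ → ℝ≥0∞} (hv : IsRepulsiveFiniteRange v)
    (hae : ∀ᵐ r ∂(volume.restrict (Set.Ioi (0 : ℝ))), v r = 0) (N : ℕ) (L : ℝ) :
    groundStateEnergy v N L = groundStateEnergy 0 N L := by
  unfold groundStateEnergy
  exact iInf_congr fun Φ => energy_eq_energy_zero hv hae Φ

/-- `ℝ≥0∞` bookkeeping of the gap argument (`q = 3π²/L² ∈ (0, ∞)`, `n = N`): if `q ≠ 0, ∞`, `n ≠ ∞` and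
`q * (n + n) ≤ q * n + q * e + q * A` then `n ≤ e + A`. [folklore] -/
theorem cancel_gap {q n e A : ℝ≥0∞} (hq0 : q ≠ 0) (hqt : q ≠ ⊤) (hn : n ≠ ⊤)
    (h : q * (n + n) ≤ q * n + q * e + q * A) : n ≤ e + A := by
  rw [← mul_add, ← mul_add] at h
  have h2 : n + n ≤ n + (e + A) := by
    have := (ENNReal.mul_le_mul_iff_right hq0 hqt).1 h
    simpa only [add_assoc] using this
  exact (ENNReal.add_le_add_iff_left hn).1 h2

/-- **The crux from the stubs** (kernel-checked composition, no `sorry` of its own). [folklore] -/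
theorem BecFreeGas_of :
    Stmt.stub_freeEnergyUpper → Stmt.stub_freeGapSineMode → Stmt.stub_sineToFlatMode →
      BECInfraredBound.BecFreeGas := by
  intro hU hG hT v hv hae
  obtain ⟨c₀, hc₀, ε₀, hε₀, hT⟩ := hT
  refine ⟨1, one_pos, fun ρ hρ _ => ⟨c₀, hc₀, ?_⟩⟩
  filter_upwards [eventually_gt_atTop 0] with N hN
  have hL : 0 < sideLength ρ N := sideLength_pos' hρ hN
  set L := sideLength ρ N with hLdef
  have hNpos : (0 : ℝ) < N := Nat.cast_pos.2 hN
  have hqpos : (0 : ℝ) < 3 * Real.pi ^ 2 / L ^ 2 := by positivity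
  have hq : (0 : ℝ) ≤ 3 * Real.pi ^ 2 / L ^ 2 := hqpos.le
  refine ⟨ENNReal.ofReal (3 * Real.pi ^ 2 / L ^ 2 * (ε₀ * N)),
    ENNReal.ofReal_pos.2 (mul_pos hqpos (mul_pos hε₀ hNpos)), fun Ψ hΨ => ?_⟩
  -- the interaction is invisible: `Ψ` is a near-minimiser of the FREE Dirichlet energy
  rw [energy_eq_energy_zero hv hae Ψ, groundStateEnergy_eq_zero hv hae N L] at hΨ
  have hUN := hU N L hN hL
  have hGN := hG N L hN hL Ψ
  apply hT N L hN hL Ψ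
  -- gap arithmetic in `ℝ≥0∞`
  have X1 := hGN.trans (add_le_add (hΨ.trans (add_le_add hUN le_rfl)) le_rfl)
  rw [show ENNReal.ofReal (6 * Real.pi ^ 2 * N / L ^ 2) =
        ENNReal.ofReal (3 * Real.pi ^ 2 / L ^ 2) * (ENNReal.ofReal (N : ℝ) + ENNReal.ofReal (N : ℝ)) by
        rw [← ENNReal.ofReal_add hNpos.le hNpos.le, ← ENNReal.ofReal_mul hq]; congr 1; ring,
      show ENNReal.ofReal (3 * Real.pi ^ 2 * N / L ^ 2) =
        ENNReal.ofReal (3 * Real.pi ^ 2 / L ^ 2) * ENNReal.ofReal (N : ℝ) by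
        rw [← ENNReal.ofReal_mul hq]; congr 1; ring,
      ENNReal.ofReal_mul hq] at X1
  have hq0 : ENNReal.ofReal (3 * Real.pi ^ 2 / L ^ 2) ≠ 0 := (ENNReal.ofReal_pos.2 hqpos).ne'
  have X3 : ENNReal.ofReal (N : ℝ) ≤ ENNReal.ofReal (ε₀ * N) + _ :=
    cancel_gap hq0 ENNReal.ofReal_ne_top ENNReal.ofReal_ne_top X1
  by_cases hε1 : 1 ≤ ε₀
  · rw [ENNReal.ofReal_of_nonpos (mul_nonpos_iff.2 (Or.inr ⟨sub_nonpos.2 hε1, hNpos.le⟩))]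
    exact zero_le
  · have hsplit : ENNReal.ofReal (N : ℝ) = ENNReal.ofReal ((1 - ε₀) * N) + ENNReal.ofReal (ε₀ * N) := by
      rw [← ENNReal.ofReal_add (mul_nonneg (sub_nonneg.2 (not_le.1 hε1).le) hNpos.le)
        (mul_nonneg hε₀.le hNpos.le)]
      congr 1; ring
    rw [hsplit] at X3
    exact (ENNReal.add_le_add_iff_right ENNReal.ofReal_ne_top).1 (X3.trans_eq (add_comm _ _))

/-- The crux BY NAME from the three registered stubs. [folklore] -/
theorem BecFreeGas_proof : BECInfraredBound.BecFreeGas :=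
  BecFreeGas_of stub_freeEnergyUpper stub_freeGapSineMode stub_sineToFlatMode

end Summit.AtomisticToContinuum.BoseEinsteinCondensation.Cruxes.BecFreeGas.Birth

end
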